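import Summits.AnomalousDissipation.AnomalousDissipation.Theorems.MirrorVarietyTaylorGreenLoudGalerkinStatesStubCriticality
import Summits.AnomalousDissipation.AnomalousDissipation.Theorems.MirrorVarietyTaylorGreenLoudGalerkinStatesStubDiscreteKantorovich
import Summits.AnomalousDissipation.AnomalousDissipation.Theorems.MirrorVarietyTaylorGreenLoudGalerkinStatesStubTgForceRegular
import Summits.AnomalousDissipation.AnomalousDissipation.Theorems.MirrorVarietyTaylorGreenLoudGalerkinStatesStubTruncation
import Summits.AnomalousDissipation.AnomalousDissipation.Theorems.TaylorGreenLogLoudStates.Negative.Eigenforce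
import Literature.Analysis.FluidPDE.SteadyNSTestedFormAlgebra

/-!
# Stub `stub_gaugeForward` of the line `stagnation-plug-froth` (skeleton v4, gauge reshape)
# (crux stmt-AnomalousDissipation-2987, `MirrorVariety.TaylorGreenLoudGalerkinStates`)

**The frozen-cell amplitude gauge, forward direction.**  Write `f := f_TG` (the Taylor–Green force
`tgForce`, a `K`-field with `∫‖f‖² = 1/4` and `Δf = −12π² f`) and `U := 2•f + v`.  If the `K`-field `v`,
orthogonal to the force (`∫⟪f, v⟫ = 0`), solves the FROZEN-CELL equations at viscosity `ν` — the tested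
steady equations `testedForm ν f U b = 0` against every `K`-field `b ⊥ f` — then `U` solves the FULL
`K`-tested steady equations at viscosity `ν` with the rescaled force `β • f`,
`β := 2ν(12π² + ‖∇v‖²)`: `testedForm ν (β • f) U a = 0` for EVERY `K`-field `a` (`stub_gaugeForward`).

Proof.  Split a `K`-field test as `a = b + t • f` with `t := 4∫⟪f, a⟫`, so that `b := a − t•f` is a
`K`-field with `∫⟪f, b⟫ = ∫⟪f, a⟫ − t/4 = 0` (`K`-fields form a real vector space: `isKField_add_smul`).
The tested form is linear in the test (`Criticality.testedForm_add/smul`) and affine in the force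
(`testedForm_smul_force`: `testedForm ν (β•g) U a = testedForm ν g U a + (β − 1)∫⟪g, a⟫`), so
* the `b`-part is `testedForm ν f U b + (β − 1)∫⟪f, b⟫ = 0 + 0` (hypothesis);
* the `f`-part is `∫⟪U,(U·∇)f⟫ + ν∫⟪U, Δf⟫ + β/4`, where `∫⟪U, Δf⟫ = −12π²∫⟪f, U⟫ = −6π²`
  (`integral_inner_laplacian_tgForce`, `∫⟪f, U⟫ = 2·¼ + 0`), and `∫⟪U,(U·∇)f⟫ = −(ν/2)‖∇v‖²`: indeed
  `(U·∇)U = 2(U·∇)f + (U·∇)v` and `∫⟪U,(U·∇)U⟫ = 0` (antisymmetry of the trilinear form,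
  `integral_inner_convect_eq_neg`), while the frozen-cell equation tested with `b := v` reads
  `∫⟪U,(U·∇)v⟫ + ν∫⟪U, Δv⟫ = 0` with `∫⟪U, Δv⟫ = 2∫⟪f, Δv⟫ + ∫⟪v, Δv⟫ = 0 − ‖∇v‖²` (Green
  `integral_inner_laplacian_comm`, `integral_inner_laplacian_eq_neg_holds`).  Hence the `f`-part is
  `−(ν/2)‖∇v‖² − 6π²ν + ν(12π² + ‖∇v‖²)/2 = 0`.

Sources: the vocabulary module `Theorems/MirrorVarietyTaylorGreenLoudGalerkinStatesLine.lean`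
(`testedForm`, `IsKField`), the landed stubs `…StubTgForceRegular` (`IsKField tgForce`), `…StubCriticality`
(linearity of `testedForm` in the test), `…StubDiscreteKantorovich` (`isKSymm_add/smul`), `…StubTruncation`
(`Truncation.testedForm_eq_add`, the split of `testedForm` into its three integrals), the negative-knowledge
files `TaylorGreenLoudGalerkinStates/Negative/Anatomy` (`integral_norm_sq_tgForce`) and
`TaylorGreenLogLoudStates/Negative/Eigenforce` (`integral_inner_laplacian_tgForce`); Temam, *Navier–Stokes
Equations* (1979) Ch. II §1 for the tested steady form.  The mathematics is folklore (an energy-type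
bookkeeping identity); no published fact is cited as a hypothesis.
-/

-- `Summit.<Summit>.<Problem>` is the tree's mandated summit-side namespace (CONVENTIONS §2); for this
-- single-conjunct summit the two coincide, so the duplicate is deliberate.
set_option linter.dupNamespace false
noncomputable section
open scoped BigOperators Topology InnerProductSpace
open Filter MeasureTheory
open Literature.Analysis.FunctionSpaces Literature.Analysis.FunctionSpaces.Torus
namespace Summit.AnomalousDissipation.AnomalousDissipation.Theorems.TaylorGreenLoudGalerkinStates.GaugeForward
open Summit.AnomalousDissipation.AnomalousDissipation.Theorems.TaylorGreenLoudGalerkinStates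
open Summit.AnomalousDissipation.AnomalousDissipation.Theorems.TaylorGreenLoudGalerkinStates.Negative
open Summit.AnomalousDissipation.AnomalousDissipation.Theorems.TaylorGreenLogLoudStates.Negative
open Summit.AnomalousDissipation.AnomalousDissipation.Theorems.TaylorGreenLoudGalerkinStates.DiscreteKantorovich

/-! ## `K`-fields form a real vector space -/

/-- `K`-fields are closed under `a + c • g`: smoothness, divergence-freeness (the divergence is the trace of
the derivative, which is linear), zero mean (linearity of the integral) and `K`-symmetry
(`isKSymm_add`, `isKSymm_smul`) are all real-linear conditions. [folklore] -/
theorem isKField_add_smul {a g : UnitAddTorus (Fin 3) → EuclideanSpace ℝ (Fin 3)} (ha : IsKField a)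
    (hg : IsKField g) (c : ℝ) : IsKField (a + c • g) := by
  obtain ⟨has, had, haz, hak⟩ := ha
  obtain ⟨hgs, hgd, hgz, hgk⟩ := hg
  have ha1 : IsContDiff 1 a := has.isContDiff (by simp)
  have hg1 : IsContDiff 1 g := hgs.isContDiff (by simp)
  refine ⟨has.add (hgs.smul c), fun x => ?_, ?_, isKSymm_add hak (isKSymm_smul c hgk)⟩
  · rw [divergence_eq_trace_fderiv (ha1.add (hg1.smul c)) x, Torus.fderiv_add ha1 (hg1.smul c),
      Torus.fderiv_const_smul hg1 c, ContinuousLinearMap.toLinearMap_add,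
      ContinuousLinearMap.toLinearMap_smul, map_add, map_smul, ← divergence_eq_trace_fderiv ha1,
      ← divergence_eq_trace_fderiv hg1, had x, hgd x, smul_zero, add_zero]
  · unfold HasZeroMean at haz hgz ⊢
    have hg' : Integrable (fun x => c • g x) volume := hgs.integrable.smul c
    simp only [Pi.add_apply, Pi.smul_apply]
    rw [integral_add has.integrable hg', integral_smul, haz, hgz, smul_zero, add_zero]

/-! ## The tested form is affine in the force -/

/-- The tested form is affine in the force: rescaling the force `g ↦ β • g` changes it by
`(β − 1)∫⟪g, a⟫` (split into the three integrals, `Truncation.testedForm_eq_add`). [folklore] -/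
theorem testedForm_smul_force (ν β : ℝ) {g U a : UnitAddTorus (Fin 3) → EuclideanSpace ℝ (Fin 3)}
    (hg : IsSmooth g) (hU : IsSmooth U) (ha : IsSmooth a) :
    testedForm ν (β • g) U a = testedForm ν g U a + (β - 1) * ∫ x, ⟪g x, a x⟫_ℝ := by
  rw [Truncation.testedForm_eq_add ν (hg.smul β) hU ha, Truncation.testedForm_eq_add ν hg hU ha]
  have h : ∫ x, ⟪(β • g) x, a x⟫_ℝ = β * ∫ x, ⟪g x, a x⟫_ℝ := by
    simp only [Pi.smul_apply, real_inner_smul_left]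
    exact integral_const_mul β _
  rw [h]
  ring

/-! ## The registered stub -/

/-- **Stub `stub_gaugeForward`** (the frozen-cell amplitude gauge, forward direction).  If the `K`-field
`v ⊥ f_TG` solves the frozen-cell equations at viscosity `ν` (tested equations of `2f_TG + v` against every
`K`-field `b ⊥ f_TG`), then `2f_TG + v` solves the FULL `K`-tested steady equations at viscosity `ν` with
the force `2ν(12π² + ‖∇v‖²) • f_TG`.  Proof: split a `K`-field test `a = b + t•f_TG`, `t = 4∫⟪f_TG, a⟫`,
`b ⊥ f_TG` a `K`-field; linearity in the test and affinity in the force reduce to the `b`-part (the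
hypothesis) and the `f_TG`-part, which is the bookkeeping identity
`−(ν/2)‖∇v‖² − 6π²ν + ν(12π² + ‖∇v‖²)/2 = 0` (antisymmetry of the trilinear form, the frozen-cell equation
tested with `v`, Green's identities and `Δf_TG = −12π²f_TG`, `∫‖f_TG‖² = ¼`). [folklore] -/
theorem stub_gaugeForward :
    ∀ (ν : ℝ) (v : UnitAddTorus (Fin 3) → EuclideanSpace ℝ (Fin 3)), IsKField v →
      (∫ x, inner ℝ (tgForce x) (v x)) = 0 →
      (∀ b, IsKField b → (∫ x, inner ℝ (tgForce x) (b x)) = 0 →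
        testedForm ν tgForce ((2 : ℝ) • tgForce + v) b = 0) →
      ∀ a, IsKField a →
        testedForm ν ((2 * ν * (12 * Real.pi ^ 2 + gradNormSq v)) • tgForce) ((2 : ℝ) • tgForce + v) a = 0 := by
  intro ν v hv hperp hcell a ha
  set β : ℝ := 2 * ν * (12 * Real.pi ^ 2 + gradNormSq v) with hβ
  set U : UnitAddTorus (Fin 3) → EuclideanSpace ℝ (Fin 3) := (2 : ℝ) • tgForce + v with hU
  -- the data
  have hfK : IsKField tgForce := TgForceRegular.stub_tgForceRegular
  have hfs : IsSmooth tgForce := isSmooth_tgForce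
  have hvs : IsSmooth v := hv.1
  have hUK : IsKField U := by
    rw [hU, add_comm]
    exact isKField_add_smul hv hfK 2
  have hUs : IsSmooth U := hUK.1
  have hUd : IsDivFree U := hUK.2.1
  -- `∫⟪f, f⟫ = 1/4`, `∫⟪f, U⟫ = 1/2`
  have hff : ∫ x, ⟪tgForce x, tgForce x⟫_ℝ = 4⁻¹ := by
    simp_rw [real_inner_self_eq_norm_sq]
    exact integral_norm_sq_tgForce
  have hfU : ∫ x, ⟪tgForce x, U x⟫_ℝ = 2⁻¹ := by
    have h1 : ∀ x, ⟪tgForce x, U x⟫_ℝ = 2 * ⟪tgForce x, tgForce x⟫_ℝ + ⟪tgForce x, v x⟫_ℝ := fun x => by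
      rw [hU, Pi.add_apply, Pi.smul_apply, inner_add_right, real_inner_smul_right]
    simp_rw [h1]
    rw [integral_add ((hfs.inner hfs).integrable.const_mul 2) (hfs.inner hvs).integrable,
      integral_const_mul, hff, hperp]
    norm_num
  -- `∫⟪U, Δf⟫ = −12π² ∫⟪f, U⟫ = −6π²`
  have hY : ∫ x, ⟪U x, laplacian tgForce x⟫_ℝ = -(12 * Real.pi ^ 2) * 2⁻¹ := by
    rw [integral_inner_laplacian_tgForce (hUs.memLp 2), hfU]
  -- `∫⟪f, Δv⟫ = ∫⟪v, Δf⟫ = −12π² ∫⟪f, v⟫ = 0`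
  have hlapfv : ∫ x, ⟪tgForce x, laplacian v x⟫_ℝ = 0 := by
    have hc : ∫ x, ⟪laplacian tgForce x, v x⟫_ℝ = ∫ x, ⟪v x, laplacian tgForce x⟫_ℝ :=
      integral_congr_ae (ae_of_all _ fun x => real_inner_comm (v x) (laplacian tgForce x))
    rw [← integral_inner_laplacian_comm hfs hvs, hc, integral_inner_laplacian_tgForce (hvs.memLp 2), hperp,
      mul_zero]
  -- `∫⟪v, Δv⟫ = −‖∇v‖²`
  have hvv : ∫ x, ⟪v x, laplacian v x⟫_ℝ = -gradNormSq v := by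
    have hint : ∀ i, Integrable (fun x => ‖partialDeriv i v x‖ ^ 2) volume := fun i =>
      ((hvs.partialDeriv i).continuous.norm.pow 2).integrable_unitAddTorus
    rw [integral_inner_laplacian_eq_neg_holds hvs, gradNormSq, integral_finsetSum _ fun i _ => hint i]
  -- `∫⟪U, Δv⟫ = −‖∇v‖²`
  have hUlapv : ∫ x, ⟪U x, laplacian v x⟫_ℝ = -gradNormSq v := by
    have h1 : ∀ x, ⟪U x, laplacian v x⟫_ℝ = 2 * ⟪tgForce x, laplacian v x⟫_ℝ + ⟪v x, laplacian v x⟫_ℝ :=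
      fun x => by rw [hU, Pi.add_apply, Pi.smul_apply, inner_add_left, real_inner_smul_left]
    simp_rw [h1]
    rw [integral_add ((hfs.inner hvs.laplacian).integrable.const_mul 2) (hvs.inner hvs.laplacian).integrable,
      integral_const_mul, hlapfv, hvv]
    ring
  -- the frozen-cell equation tested with `v`: `∫⟪U,(U·∇)v⟫ = ν‖∇v‖²`
  have hconv_v : ∫ x, ⟪U x, convect U v x⟫_ℝ = ν * gradNormSq v := by
    have h := hcell v hv hperp
    rw [Truncation.testedForm_eq_add ν hfs hUs hvs, hUlapv, hperp] at h
    linear_combination h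
  -- antisymmetry: `∫⟪U,(U·∇)U⟫ = 0`
  have hanti : ∫ x, ⟪U x, convect U U x⟫_ℝ = 0 := by
    have h1 := integral_inner_convect_eq_neg hUs hUd hUs hUs
    have h2 : ∫ x, ⟪convect U U x, U x⟫_ℝ = ∫ x, ⟪U x, convect U U x⟫_ℝ :=
      integral_congr_ae (ae_of_all _ fun x => real_inner_comm _ _)
    linarith
  -- `(U·∇)U = 2(U·∇)f + (U·∇)v`
  have hconvUU : ∀ x, convect U U x = (2 : ℝ) • convect U tgForce x + convect U v x := fun x => by
    simp only [Torus.convect]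
    rw [hU, Torus.fderiv_add ((hfs.smul 2).isContDiff (by simp)) (hvs.isContDiff (by simp)),
      Torus.fderiv_const_smul (hfs.isContDiff (by simp)) 2]
    rfl
  -- hence `∫⟪U,(U·∇)f⟫ = −(ν/2)‖∇v‖²`
  have hX : ∫ x, ⟪U x, convect U tgForce x⟫_ℝ = -(ν / 2) * gradNormSq v := by
    have h1 : ∫ x, ⟪U x, convect U U x⟫_ℝ =
        2 * (∫ x, ⟪U x, convect U tgForce x⟫_ℝ) + ∫ x, ⟪U x, convect U v x⟫_ℝ := by
      simp_rw [hconvUU, inner_add_right, real_inner_smul_right]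
      rw [integral_add ((hUs.inner (hUs.convect hfs)).integrable.const_mul 2)
        (hUs.inner (hUs.convect hvs)).integrable, integral_const_mul]
    rw [hanti, hconv_v] at h1
    linear_combination (-(1 : ℝ) / 2) * h1
  -- the `f`-part vanishes
  have hfpart : testedForm ν (β • tgForce) U tgForce = 0 := by
    have h3 : ∫ x, ⟪(β • tgForce) x, tgForce x⟫_ℝ = β * 4⁻¹ := by
      simp only [Pi.smul_apply, real_inner_smul_left]
      rw [integral_const_mul, hff]
    rw [Truncation.testedForm_eq_add ν (hfs.smul β) hUs hfs, hX, hY, h3, hβ]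
    ring
  -- the `b`-part: `b := a − t • f` with `t := 4∫⟪f, a⟫` is a `K`-field orthogonal to the force
  set t : ℝ := 4 * ∫ x, ⟪tgForce x, a x⟫_ℝ with ht
  have hb : IsKField (a + (-t) • tgForce) := isKField_add_smul ha hfK (-t)
  have hbperp : ∫ x, ⟪tgForce x, (a + (-t) • tgForce) x⟫_ℝ = 0 := by
    have h1 : ∀ x, ⟪tgForce x, (a + (-t) • tgForce) x⟫_ℝ =
        ⟪tgForce x, a x⟫_ℝ + (-t) * ⟪tgForce x, tgForce x⟫_ℝ := fun x => by
      rw [Pi.add_apply, Pi.smul_apply, inner_add_right, real_inner_smul_right]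
    simp_rw [h1]
    rw [integral_add (hfs.inner ha.1).integrable ((hfs.inner hfs).integrable.const_mul _), integral_const_mul,
      hff, ht]
    ring
  have hbpart : testedForm ν (β • tgForce) U (a + (-t) • tgForce) = 0 := by
    rw [testedForm_smul_force ν β hfs hUs hb.1, hcell _ hb hbperp, hbperp, mul_zero, add_zero]
  -- assembly: `a = b + t • f` and linearity in the test
  have hsum : a + (-t) • tgForce + t • tgForce = a := by
    rw [add_assoc, neg_smul, neg_add_cancel, add_zero]
  have key := Criticality.testedForm_add (ν := ν) (hfs.smul β) hUs hb.1 (hfs.smul t)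
  rw [hsum, Criticality.testedForm_smul t hfs, hbpart, hfpart, mul_zero, add_zero] at key
  exact key

end Summit.AnomalousDissipation.AnomalousDissipation.Theorems.TaylorGreenLoudGalerkinStates.GaugeForward

end
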